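import Mathlib

/-!
# Crux `WordLengthQP` (stmt-ValiantsHypothesis-6623), line `Sketch` (eps-order-ladder) —
stub `stub_mainAW`, infrastructure file 1 (assignments)

Infrastructure for the Allender–Wang cutting/finishing argument (Allender–Wang 2016,
ECCC TR11-083, §3.3 Lemma 26, Obs. 29/33, Thm 34; §4.1 Thm 38) in the S-affine width-2 model:
assignment homomorphisms `x_v ↦ a_v (v ∈ Z)` — composition, absorption, action on S-affine
matrices, on determinants, on register rows and on program values
`((A.map C) * ms.prod * (B.map C)) 0 0` — and splitting a program at a constant matrix of
rank `≤ 1`.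
-/

-- `Summit.ValiantsHypothesis.ValiantsHypothesis.…` is the tree's mandated single-conjunct layout
-- (Sub = Summit), so the duplicated namespace component is intended.
set_option linter.dupNamespace false

noncomputable section

open MvPolynomial

namespace Summit.ValiantsHypothesis.ValiantsHypothesis.Cruxes.WordLengthQP.EpsOrderLadder

/-! ### (I1)–(I2) Assignment homomorphisms -/

/-- A `ℂ`-algebra endomorphism of `ℂ[x̄]` fixes constants. [folklore] -/
theorem mainAW_hom_C {σ : Type*} (φ : MvPolynomial σ ℂ →ₐ[ℂ] MvPolynomial σ ℂ) (c : ℂ) :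
    φ (C c) = C c := by
  rw [algHom_C, algebraMap_eq]

/-- The empty assignment is the identity. [folklore] -/
theorem mainAW_asg_empty {σ : Type*} [DecidableEq σ] (a : σ → ℂ) (p : MvPolynomial σ ℂ) :
    aeval (fun w : σ => if w ∈ (∅ : Finset σ) then C (a w) else (X w : MvPolynomial σ ℂ)) p =
      p := by
  have h : (fun w : σ => if w ∈ (∅ : Finset σ) then C (a w) else (X w : MvPolynomial σ ℂ)) =
      X := by
    funext w
    simp
  rw [h, aeval_X_left_apply]

/-- Composition of two assignments is the assignment on the union (the first assignment wins on
its support). [folklore] -/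
theorem mainAW_asg_comp {σ : Type*} [DecidableEq σ] (Z₁ Z₂ : Finset σ) (a₁ a₂ : σ → ℂ)
    (p : MvPolynomial σ ℂ) :
    aeval (fun w : σ => if w ∈ Z₂ then C (a₂ w) else (X w : MvPolynomial σ ℂ))
      (aeval (fun w : σ => if w ∈ Z₁ then C (a₁ w) else (X w : MvPolynomial σ ℂ)) p) =
    aeval (fun w : σ => if w ∈ Z₁ ∪ Z₂ then C (if w ∈ Z₁ then a₁ w else a₂ w)
      else (X w : MvPolynomial σ ℂ)) p := by
  rw [← AlgHom.comp_apply]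
  congr 1
  refine algHom_ext fun v => ?_
  rw [AlgHom.comp_apply, aeval_X, aeval_X]
  by_cases h₁ : v ∈ Z₁
  · rw [if_pos h₁, if_pos (Finset.mem_union_left _ h₁), if_pos h₁, mainAW_hom_C]
  · rw [if_neg h₁, aeval_X, if_neg h₁]
    by_cases h₂ : v ∈ Z₂
    · rw [if_pos h₂, if_pos (Finset.mem_union_right _ h₂)]
    · rw [if_neg h₂, if_neg (by simp [h₁, h₂])]

/-- Transfer of robustness along an assignment: if `f` is `K`-robust and `Z.card + K' ≤ K` then
the assigned polynomial is `K'`-robust. [folklore] -/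
theorem mainAW_robust_transfer {σ : Type*} [DecidableEq σ] (f : MvPolynomial σ ℂ) (K K' : ℕ)
    (hrob : ∀ (Z : Finset σ) (a : σ → ℂ), Z.card ≤ K → ∀ f' : MvPolynomial σ ℂ,
      f' = aeval (fun v : σ => if v ∈ Z then C (a v) else X v) f →
      2 ≤ f'.totalDegree ∧ ¬ ∃ g h : MvPolynomial σ ℂ, 0 < g.totalDegree ∧ 0 < h.totalDegree ∧
        homogeneousComponent f'.totalDegree f' = g * h)
    (Z : Finset σ) (a : σ → ℂ) (hZ : Z.card + K' ≤ K) (p : MvPolynomial σ ℂ)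
    (hp : p = aeval (fun v : σ => if v ∈ Z then C (a v) else X v) f) :
    ∀ (Z' : Finset σ) (a' : σ → ℂ), Z'.card ≤ K' → ∀ f' : MvPolynomial σ ℂ,
      f' = aeval (fun v : σ => if v ∈ Z' then C (a' v) else X v) p →
      2 ≤ f'.totalDegree ∧ ¬ ∃ g h : MvPolynomial σ ℂ, 0 < g.totalDegree ∧ 0 < h.totalDegree ∧
        homogeneousComponent f'.totalDegree f' = g * h := by
  intro Z' a' hZ' f' hf'
  refine hrob (Z ∪ Z') (fun w => if w ∈ Z then a w else a' w)
    ((Finset.card_union_le _ _).trans (by omega)) f' ?_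
  rw [hf', hp, mainAW_asg_comp]

/-! ### (I1), (I3) Matrices and program values under algebra endomorphisms -/

/-- Constant boundary matrices are fixed. [folklore] -/
theorem mainAW_constMap_map {σ : Type*} (φ : MvPolynomial σ ℂ →ₐ[ℂ] MvPolynomial σ ℂ)
    (A : Matrix (Fin 2) (Fin 2) ℂ) :
    (A.map (C (σ := σ) (R := ℂ))).map φ = A.map C := by
  ext i j
  simp only [Matrix.map_apply, mainAW_hom_C]

/-- Determinant of the mapped matrix. [folklore] -/
theorem mainAW_det_map {σ : Type*} (φ : MvPolynomial σ ℂ →ₐ[ℂ] MvPolynomial σ ℂ)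
    (m : Matrix (Fin 2) (Fin 2) (MvPolynomial σ ℂ)) :
    (m.map φ).det = φ m.det := by
  rw [AlgHom.map_det, AlgHom.mapMatrix_apply]

/-- Unit determinants are preserved. [folklore] -/
theorem mainAW_indg_map {σ : Type*} (φ : MvPolynomial σ ℂ →ₐ[ℂ] MvPolynomial σ ℂ)
    (m : Matrix (Fin 2) (Fin 2) (MvPolynomial σ ℂ)) (h : ∃ d : ℂ, d ≠ 0 ∧ m.det = C d) :
    ∃ d : ℂ, d ≠ 0 ∧ (m.map φ).det = C d := by
  obtain ⟨d, hd, hdet⟩ := h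
  exact ⟨d, hd, by rw [mainAW_det_map, hdet, mainAW_hom_C]⟩

/-- An assignment maps S-affine matrices to S-affine matrices. [folklore] -/
theorem mainAW_saff_map {σ : Type*} [DecidableEq σ] (Z : Finset σ) (a : σ → ℂ)
    (m : Matrix (Fin 2) (Fin 2) (MvPolynomial σ ℂ))
    (hm : ∀ i j : Fin 2, (∃ b : ℂ, m i j = C b) ∨
      (∃ (a b : ℂ) (v : σ), m i j = C a * X v + C b)) :
    ∀ i j : Fin 2,
      (∃ b : ℂ, (m.map (aeval (fun w : σ => if w ∈ Z then C (a w) else (X w : MvPolynomial σ ℂ))))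
          i j = C b) ∨
      (∃ (a' b : ℂ) (v : σ),
        (m.map (aeval (fun w : σ => if w ∈ Z then C (a w) else (X w : MvPolynomial σ ℂ)))) i j =
          C a' * X v + C b) := by
  intro i j
  rw [Matrix.map_apply]
  rcases hm i j with ⟨b, hb⟩ | ⟨a', b, v, hab⟩
  · exact Or.inl ⟨b, by rw [hb, mainAW_hom_C]⟩
  · rw [hab, map_add, map_mul, mainAW_hom_C, mainAW_hom_C, aeval_X]
    by_cases hv : v ∈ Z
    · rw [if_pos hv]
      exact Or.inl ⟨a' * a v + b, by simp only [map_add, map_mul]⟩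
    · rw [if_neg hv]
      exact Or.inr ⟨a', b, v, rfl⟩

/-- Program values commute with algebra endomorphisms (I3). [folklore] -/
theorem mainAW_val_map {σ : Type*} (φ : MvPolynomial σ ℂ →ₐ[ℂ] MvPolynomial σ ℂ)
    (A B : Matrix (Fin 2) (Fin 2) ℂ) (ms : List (Matrix (Fin 2) (Fin 2) (MvPolynomial σ ℂ))) :
    φ (((A.map (C (σ := σ) (R := ℂ))) * ms.prod * (B.map (C (σ := σ) (R := ℂ)))) 0 0) =
      ((A.map (C (σ := σ) (R := ℂ))) * (ms.map (fun m => m.map φ)).prod *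
        (B.map (C (σ := σ) (R := ℂ)))) 0 0 := by
  have h1 : φ (((A.map (C (σ := σ) (R := ℂ))) * ms.prod * (B.map (C (σ := σ) (R := ℂ)))) 0 0) =
      (φ.mapMatrix
        ((A.map (C (σ := σ) (R := ℂ))) * ms.prod * (B.map (C (σ := σ) (R := ℂ))))) 0 0 := by
    rw [AlgHom.mapMatrix_apply, Matrix.map_apply]
  rw [h1, map_mul, map_mul, map_list_prod]
  have h2 : ms.map ⇑φ.mapMatrix = ms.map (fun m => m.map φ) :=
    List.map_congr_left fun m _ => AlgHom.mapMatrix_apply φ m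
  rw [h2, AlgHom.mapMatrix_apply, AlgHom.mapMatrix_apply, mainAW_constMap_map,
    mainAW_constMap_map]

/-- The register row commutes with algebra endomorphisms. [folklore] -/
theorem mainAW_row_map {σ : Type*} (φ : MvPolynomial σ ℂ →ₐ[ℂ] MvPolynomial σ ℂ)
    (A : Matrix (Fin 2) (Fin 2) ℂ) (L : List (Matrix (Fin 2) (Fin 2) (MvPolynomial σ ℂ)))
    (M : Matrix (Fin 2) (Fin 2) (MvPolynomial σ ℂ)) (j : Fin 2) :
    φ (((A.map (C (σ := σ) (R := ℂ))) * L.prod * M) 0 j) =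
      ((A.map (C (σ := σ) (R := ℂ))) * (L.map (fun m => m.map φ)).prod * M.map φ) 0 j := by
  have h1 : φ (((A.map (C (σ := σ) (R := ℂ))) * L.prod * M) 0 j) =
      (φ.mapMatrix ((A.map (C (σ := σ) (R := ℂ))) * L.prod * M)) 0 j := by
    rw [AlgHom.mapMatrix_apply, Matrix.map_apply]
  rw [h1, map_mul, map_mul, map_list_prod]
  have h2 : L.map ⇑φ.mapMatrix = L.map (fun m => m.map φ) :=
    List.map_congr_left fun m _ => AlgHom.mapMatrix_apply φ m
  rw [h2, AlgHom.mapMatrix_apply, AlgHom.mapMatrix_apply, mainAW_constMap_map]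

/-- A matrix all of whose entries are mapped to constants is mapped to a constant matrix.
[folklore] -/
theorem mainAW_constMat {σ : Type*} (φ : MvPolynomial σ ℂ →ₐ[ℂ] MvPolynomial σ ℂ)
    (m : Matrix (Fin 2) (Fin 2) (MvPolynomial σ ℂ)) (h : ∀ i j : Fin 2, ∃ c : ℂ, φ (m i j) = C c) :
    ∃ N : Matrix (Fin 2) (Fin 2) ℂ, m.map φ = N.map C := by
  choose N hN using h
  exact ⟨Matrix.of N, by ext i j : 1; rw [Matrix.map_apply, Matrix.map_apply, Matrix.of_apply, hN]⟩

/-! ### (I4) Splitting a program at a constant matrix of rank `≤ 1` -/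

/-- A singular constant `2 × 2` matrix is an outer product `u * vᵀ`. [folklore] -/
theorem mainAW_rank1 (N : Matrix (Fin 2) (Fin 2) ℂ) (h : N.det = 0) :
    ∃ u v : Fin 2 → ℂ, ∀ i j : Fin 2, N i j = u i * v j := by
  rw [Matrix.det_fin_two] at h
  by_cases h00 : N 0 0 = 0
  · by_cases h10 : N 1 0 = 0
    · refine ⟨fun i => N i 1, ![0, 1], fun i j => ?_⟩
      fin_cases i <;> fin_cases j <;> simp [h00, h10]
    · have h01 : N 0 1 = 0 := by
        rw [h00, zero_mul, zero_sub, neg_eq_zero] at h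
        exact (mul_eq_zero.1 h).resolve_right h10
      refine ⟨fun i => N i 0, ![1, N 1 1 / N 1 0], fun i j => ?_⟩
      fin_cases i <;> fin_cases j <;> simp [h00, h01]
      field_simp
  · refine ⟨fun i => N i 0, ![1, N 0 1 / N 0 0], fun i j => ?_⟩
    fin_cases i <;> fin_cases j <;> simp
    · field_simp
    · field_simp
      linear_combination h

/-- The `(0,0)` entry of `P * N * Q` for a constant outer product `N = u vᵀ` factors through the
column matrix of `u` and the row matrix of `v`. [folklore] -/
theorem mainAW_split00 {σ : Type*} (N : Matrix (Fin 2) (Fin 2) ℂ) (u v : Fin 2 → ℂ)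
    (hN : ∀ i j : Fin 2, N i j = u i * v j) (P Q : Matrix (Fin 2) (Fin 2) (MvPolynomial σ ℂ)) :
    (P * N.map (C (σ := σ) (R := ℂ)) * Q) 0 0 =
      (P * (!![u 0, 0; u 1, 0] : Matrix (Fin 2) (Fin 2) ℂ).map (C (σ := σ) (R := ℂ))) 0 0 *
        ((!![v 0, v 1; 0, 0] : Matrix (Fin 2) (Fin 2) ℂ).map (C (σ := σ) (R := ℂ)) * Q) 0 0 := by
  simp only [Matrix.mul_apply, Fin.sum_univ_two, Matrix.map_apply, hN, map_mul]
  simp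
  ring

/-- The register row after a constant outer product `N = u vᵀ`. [folklore] -/
theorem mainAW_split_row {σ : Type*} (N : Matrix (Fin 2) (Fin 2) ℂ) (u v : Fin 2 → ℂ)
    (hN : ∀ i j : Fin 2, N i j = u i * v j) (P : Matrix (Fin 2) (Fin 2) (MvPolynomial σ ℂ))
    (j : Fin 2) :
    (P * N.map (C (σ := σ) (R := ℂ))) 0 j =
      (P * (!![u 0, 0; u 1, 0] : Matrix (Fin 2) (Fin 2) ℂ).map (C (σ := σ) (R := ℂ))) 0 0 *
        C (v j) := by
  simp only [Matrix.mul_apply, Fin.sum_univ_two, Matrix.map_apply, hN, map_mul]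
  simp
  ring

/-- Splitting a program value at a constant outer product (I4). [folklore] -/
theorem mainAW_val_split {σ : Type} (A B N : Matrix (Fin 2) (Fin 2) ℂ) (u v : Fin 2 → ℂ)
    (hN : ∀ i j : Fin 2, N i j = u i * v j)
    (pre suf : List (Matrix (Fin 2) (Fin 2) (MvPolynomial σ ℂ))) :
    ((A.map (MvPolynomial.C (σ := σ) (R := ℂ))) *
        (pre ++ N.map (MvPolynomial.C (σ := σ) (R := ℂ)) :: suf).prod *
        (B.map (MvPolynomial.C (σ := σ) (R := ℂ)))) 0 0 =
      ((A.map (MvPolynomial.C (σ := σ) (R := ℂ))) * pre.prod *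
          (!![u 0, 0; u 1, 0] : Matrix (Fin 2) (Fin 2) ℂ).map (MvPolynomial.C (σ := σ) (R := ℂ)))
          0 0 *
        ((!![v 0, v 1; 0, 0] : Matrix (Fin 2) (Fin 2) ℂ).map (MvPolynomial.C (σ := σ) (R := ℂ)) *
          suf.prod * (B.map (MvPolynomial.C (σ := σ) (R := ℂ)))) 0 0 := by
  rw [List.prod_append, List.prod_cons]
  have hassoc : (A.map (C (σ := σ) (R := ℂ))) * (pre.prod * (N.map C * suf.prod)) *
      (B.map (C (σ := σ) (R := ℂ))) =
      (A.map (C (σ := σ) (R := ℂ))) * pre.prod * N.map C *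
        (suf.prod * (B.map (C (σ := σ) (R := ℂ)))) := by
    simp only [Matrix.mul_assoc]
  rw [hassoc, mainAW_split00 N u v hN]
  simp only [Matrix.mul_assoc]

/-- Pulling a scalar out of the right boundary matrix. [folklore] -/
theorem mainAW_val_smul {σ : Type*} (P : Matrix (Fin 2) (Fin 2) (MvPolynomial σ ℂ))
    (κ : ℂ) (U : Matrix (Fin 2) (Fin 2) ℂ) :
    (P * (κ • U).map (C (σ := σ) (R := ℂ))) 0 0 = C κ * (P * U.map (C (σ := σ) (R := ℂ))) 0 0 := by
  simp only [Matrix.mul_apply, Fin.sum_univ_two, Matrix.map_apply, Matrix.smul_apply, smul_eq_mul,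
    map_mul]
  ring

/-- If the register row after `M` is constant, the program value only depends on the rest of the
program started from that constant row. [folklore] -/
theorem mainAW_val_constRow {σ : Type*} (P M Q : Matrix (Fin 2) (Fin 2) (MvPolynomial σ ℂ))
    (κ : Fin 2 → ℂ) (h : ∀ j : Fin 2, (P * M) 0 j = C (κ j)) :
    (P * M * Q) 0 0 =
      ((!![κ 0, κ 1; 0, 0] : Matrix (Fin 2) (Fin 2) ℂ).map (C (σ := σ) (R := ℂ)) * Q) 0 0 := by
  rw [Matrix.mul_apply, Fin.sum_univ_two, h 0, h 1]
  simp [Matrix.mul_apply, Fin.sum_univ_two]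

/-! ### (I2') Shrinking and absorbing assignments -/

/-- An assignment containing the variables of an S-affine matrix makes all its entries constant.
[folklore] -/
theorem mainAW_asg_const {σ : Type*} [DecidableEq σ] (V Z : Finset σ) (a : σ → ℂ)
    (m : Matrix (Fin 2) (Fin 2) (MvPolynomial σ ℂ))
    (hm : ∀ i j : Fin 2, (∃ b : ℂ, m i j = C b) ∨
      (∃ (a b : ℂ) (v : σ), v ∈ V ∧ m i j = C a * X v + C b))
    (hVZ : V ⊆ Z) :
    ∀ i j : Fin 2, ∃ c : ℂ,
      aeval (fun w : σ => if w ∈ Z then C (a w) else (X w : MvPolynomial σ ℂ)) (m i j) = C c := by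
  intro i j
  rcases hm i j with ⟨b, hb⟩ | ⟨a', b, v, hv, hab⟩
  · exact ⟨b, by rw [hb, mainAW_hom_C]⟩
  · refine ⟨a' * a v + b, ?_⟩
    rw [hab, map_add, map_mul, mainAW_hom_C, mainAW_hom_C, aeval_X, if_pos (hVZ hv), map_add,
      map_mul]

/-- Shrinking an assignment to the variables of an S-affine matrix does not change the assigned
matrix. [folklore] -/
theorem mainAW_asg_shrink {σ : Type*} [DecidableEq σ] (V Z : Finset σ) (a : σ → ℂ)
    (m : Matrix (Fin 2) (Fin 2) (MvPolynomial σ ℂ))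
    (hm : ∀ i j : Fin 2, (∃ b : ℂ, m i j = C b) ∨
      (∃ (a b : ℂ) (v : σ), v ∈ V ∧ m i j = C a * X v + C b)) :
    m.map (aeval (fun w : σ => if w ∈ Z ∩ V then C (a w) else (X w : MvPolynomial σ ℂ))) =
      m.map (aeval (fun w : σ => if w ∈ Z then C (a w) else (X w : MvPolynomial σ ℂ))) := by
  ext i j : 1
  rw [Matrix.map_apply, Matrix.map_apply]
  rcases hm i j with ⟨b, hb⟩ | ⟨a', b, v, hv, hab⟩
  · rw [hb, mainAW_hom_C, mainAW_hom_C]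
  · rw [hab]
    simp only [map_add, map_mul, mainAW_hom_C, aeval_X, Finset.mem_inter, hv, and_true]

/-- A larger assignment with the same values absorbs a smaller one. [folklore] -/
theorem mainAW_asg_absorb {σ : Type*} [DecidableEq σ] (Z' Z : Finset σ) (hZ : Z' ⊆ Z) (a : σ → ℂ)
    (q : MvPolynomial σ ℂ) :
    aeval (fun w : σ => if w ∈ Z then C (a w) else (X w : MvPolynomial σ ℂ))
      (aeval (fun w : σ => if w ∈ Z' then C (a w) else (X w : MvPolynomial σ ℂ)) q) =
    aeval (fun w : σ => if w ∈ Z then C (a w) else (X w : MvPolynomial σ ℂ)) q := by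
  rw [mainAW_asg_comp]
  have h : (fun w : σ => if w ∈ Z' ∪ Z then C (if w ∈ Z' then a w else a w)
      else (X w : MvPolynomial σ ℂ)) = fun w => if w ∈ Z then C (a w) else X w := by
    funext w
    rw [ite_self, Finset.union_eq_right.2 hZ]
  rw [h]

/-- Evaluating at `a` after assigning the values `a` on `Z` is evaluating at `a`. [folklore] -/
theorem mainAW_eval_asg {σ : Type*} [DecidableEq σ] (Z : Finset σ) (a : σ → ℂ)
    (q : MvPolynomial σ ℂ) :
    eval a (aeval (fun w : σ => if w ∈ Z then C (a w) else (X w : MvPolynomial σ ℂ)) q) =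
      eval a q := by
  have key : (eval a).comp
      (aeval (fun w : σ => if w ∈ Z then C (a w) else (X w : MvPolynomial σ ℂ)) :
        MvPolynomial σ ℂ →ₐ[ℂ] MvPolynomial σ ℂ).toRingHom = eval a := by
    refine ringHom_ext (fun r => ?_) (fun i => ?_)
    · simp
    · simp only [RingHom.comp_apply, AlgHom.toRingHom_eq_coe, AlgHom.coe_toRingHom, aeval_X]
      split_ifs <;> simp
  exact RingHom.congr_fun key q

/-- Absorbing a sub-assignment inside a register row. [folklore] -/
theorem mainAW_row_absorb {σ : Type} [DecidableEq σ] (Z' Z : Finset σ) (hZ : Z' ⊆ Z) (a : σ → ℂ)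
    (A : Matrix (Fin 2) (Fin 2) ℂ) (pre : List (Matrix (Fin 2) (Fin 2) (MvPolynomial σ ℂ)))
    (m : Matrix (Fin 2) (Fin 2) (MvPolynomial σ ℂ)) (j : Fin 2) :
    MvPolynomial.aeval
      (fun w : σ => if w ∈ Z then MvPolynomial.C (a w) else (MvPolynomial.X w : MvPolynomial σ ℂ))
      (((A.map (MvPolynomial.C (σ := σ) (R := ℂ))) *
        (pre.map (fun m' => m'.map (MvPolynomial.aeval (fun w : σ => if w ∈ Z' then
          MvPolynomial.C (a w) else (MvPolynomial.X w : MvPolynomial σ ℂ))))).prod *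
        m.map (MvPolynomial.aeval (fun w : σ => if w ∈ Z' then
          MvPolynomial.C (a w) else (MvPolynomial.X w : MvPolynomial σ ℂ)))) 0 j) =
    ((A.map (MvPolynomial.C (σ := σ) (R := ℂ))) *
      (pre.map (fun m' => m'.map (MvPolynomial.aeval (fun w : σ => if w ∈ Z then
        MvPolynomial.C (a w) else (MvPolynomial.X w : MvPolynomial σ ℂ))))).prod *
      m.map (MvPolynomial.aeval (fun w : σ => if w ∈ Z then
        MvPolynomial.C (a w) else (MvPolynomial.X w : MvPolynomial σ ℂ)))) 0 j := by
  have habs : ∀ m₀ : Matrix (Fin 2) (Fin 2) (MvPolynomial σ ℂ),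
      (m₀.map (aeval (fun w : σ => if w ∈ Z' then C (a w) else (X w : MvPolynomial σ ℂ)))).map
        (aeval (fun w : σ => if w ∈ Z then C (a w) else (X w : MvPolynomial σ ℂ))) =
      m₀.map (aeval (fun w : σ => if w ∈ Z then C (a w) else (X w : MvPolynomial σ ℂ))) := by
    intro m₀
    ext i k : 1
    simp only [Matrix.map_apply]
    exact mainAW_asg_absorb Z' Z hZ a _
  rw [mainAW_row_map, List.map_map]
  simp only [Function.comp_def, habs]

end Summit.ValiantsHypothesis.ValiantsHypothesis.Cruxes.WordLengthQP.EpsOrderLadder
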